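import Mathlib
import Summits.Ventures.PercRepro2.SwCheck
import Summits.Ventures.PercRepro2.SwAllRow

/-!
# Row 2′SW-ALL on an explicit small graph from a kernel-checked certificate (blind cell
PercRepro2, night-4 g38, 2026-08-29; proofs/NIGHT4-G38.md §7)

g15's checker (`SwCheck.checkSw`) certifies row (SW): every `Q`-point is sent, injectively, to a
`Q`-point whose blue cluster of `h` contains its red cluster of `h`.  The RIGID row 2′SW-ALL
(`LocRows.SwAll`) asks more: every RED EDGE INSIDE the red cluster of `h` of the source is BLUE in
the image.  `redInsideMask es ω h` is the bitmask of those edges (`testBit_redInsideMask_iff`),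
`okPairAll` checks the image is a `Q`-point below `2^m` with no red edge of that mask
(`okPairAll_spec`), `checkSwAll` runs g15's loop with it, and **`swAll_of_checkSwAll`**: a table
accepted by the checker gives `LocRows.SwAll (endsOf es) l h o` — for a concrete graph the
certificate is checked by `decide +kernel`, standard axioms only.  Use: the two pairs of the
`n = 7` census that no weak-cube block decomposition reaches (mining/night-4/g38/README.md §G′).
-/

namespace Summit.Ventures.PercRepro2

namespace SwCheck

open Hull LocRows

variable {n : ℕ}

/-! ## The red edges inside the red cluster of `h` -/

/-- The bit `2^k` when the `k`-th edge `(a, b)` is red at `ω` with both ends in the vertex mask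
`C`, else `0`. -/
def edgeBit (ω C k : ℕ) : Option (Fin n × Fin n) → ℕ
  | some (a, b) => if ω.testBit k && C.testBit a.val && C.testBit b.val then 2 ^ k else 0
  | none => 0

/-- The bits of `edgeBit`. -/
lemma testBit_edgeBit_iff (ω C k : ℕ) (oe : Option (Fin n × Fin n)) (i : ℕ) :
    (edgeBit ω C k oe).testBit i = true ↔
      i = k ∧ ∃ a b, oe = some (a, b) ∧ ω.testBit k = true ∧ C.testBit a.val = true ∧
        C.testBit b.val = true := by
  rcases oe with _ | ⟨a, b⟩
  · simp [edgeBit]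
  · simp only [edgeBit]
    by_cases hc : (ω.testBit k && C.testBit a.val && C.testBit b.val) = true
    · rw [if_pos hc, Nat.testBit_two_pow]
      simp only [Bool.and_eq_true] at hc
      constructor
      · intro hik
        simp only [decide_eq_true_eq] at hik
        exact ⟨hik.symm, a, b, rfl, hc.1.1, hc.1.2, hc.2⟩
      · rintro ⟨rfl, -⟩
        simp
    · rw [if_neg hc]
      constructor
      · intro hfalse
        rw [Nat.zero_testBit] at hfalse
        exact absurd hfalse (by decide)
      · rintro ⟨-, a', b', hab, hω, ha, hb⟩
        simp only [Option.some.injEq, Prod.mk.injEq] at hab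
        obtain ⟨rfl, rfl⟩ := hab
        exact absurd (by simp [hω, ha, hb]) hc

/-- The bits `i < k` of the red edges of `ω` with both ends in the vertex mask `C`. -/
def redInsideAux (es : List (Fin n × Fin n)) (ω C : ℕ) : ℕ → ℕ
  | 0 => 0
  | k + 1 => edgeBit ω C k es[k]? ||| redInsideAux es ω C k

/-- The bits of `redInsideAux`. -/
lemma testBit_redInsideAux_iff (es : List (Fin n × Fin n)) (ω C : ℕ) (k i : ℕ) :
    (redInsideAux es ω C k).testBit i = true ↔
      i < k ∧ ∃ a b, es[i]? = some (a, b) ∧ ω.testBit i = true ∧ C.testBit a.val = true ∧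
        C.testBit b.val = true := by
  induction k with
  | zero => simp [redInsideAux]
  | succ k ih =>
    simp only [redInsideAux, Nat.testBit_lor, Bool.or_eq_true, ih, testBit_edgeBit_iff]
    constructor
    · rintro (⟨rfl, a, b, hab, hω, ha, hb⟩ | ⟨hik, a, b, hab, hω, ha, hb⟩)
      · exact ⟨Nat.lt_succ_self _, a, b, hab, hω, ha, hb⟩
      · exact ⟨Nat.lt_succ_of_lt hik, a, b, hab, hω, ha, hb⟩
    · rintro ⟨hik, a, b, hab, hω, ha, hb⟩
      rcases Nat.lt_succ_iff_lt_or_eq.1 hik with hlt | rfl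
      · exact Or.inr ⟨hlt, a, b, hab, hω, ha, hb⟩
      · exact Or.inl ⟨rfl, a, b, hab, hω, ha, hb⟩

/-- The bitmask of the red edges inside the red cluster of `h` at `ω`. -/
def redInsideMask (es : List (Fin n × Fin n)) (ω : ℕ) (h : Fin n) : ℕ :=
  redInsideAux es ω (clusterMask ω es h) es.length

/-- An edge of the graph lies in the mask iff it is red and inside the red cluster of `h`. -/
lemma testBit_redInsideMask_iff (es : List (Fin n × Fin n)) (ω : ℕ) (h : Fin n)
    (e : Fin es.length) :
    (redInsideMask es ω h).testBit e.val = true ↔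
      toConfig es.length ω e = true ∧
        e ∈ within (endsOf es) (cluster (endsOf es) (toConfig es.length ω) h) := by
  rw [redInsideMask, testBit_redInsideAux_iff]
  have hget : es[e.val]? = some (es.get e) := List.getElem?_eq_getElem e.isLt
  constructor
  · rintro ⟨-, a, b, hab, hω, ha, hb⟩
    rw [hget, Option.some.injEq] at hab
    refine ⟨hω, ?_⟩
    refine ⟨a, (clusterMask_testBit_iff ω es h a).1 ha, b, (clusterMask_testBit_iff ω es h b).1 hb, ?_⟩
    simp only [endsOf, hab]
  · rintro ⟨hω, x, hx, y, hy, hexy⟩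
    refine ⟨e.isLt, (es.get e).1, (es.get e).2, by rw [hget], hω, ?_, ?_⟩
    · have : (es.get e).1 ∈ cluster (endsOf es) (toConfig es.length ω) h := by
        simp only [endsOf, Sym2.eq_iff] at hexy
        rcases hexy with ⟨rfl, -⟩ | ⟨rfl, -⟩
        · exact hx
        · exact hy
      exact (clusterMask_testBit_iff ω es h _).2 this
    · have : (es.get e).2 ∈ cluster (endsOf es) (toConfig es.length ω) h := by
        simp only [endsOf, Sym2.eq_iff] at hexy
        rcases hexy with ⟨-, rfl⟩ | ⟨-, rfl⟩
        · exact hy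
        · exact hx
      exact (clusterMask_testBit_iff ω es h _).2 this

/-! ## The rigid checker -/

/-- The checks on a source `ω` and its image `η`: `η` is a configuration of `Q` below `2^m` and no
red edge inside the red cluster of `h` at `ω` is red at `η`. -/
def okPairAll (es : List (Fin n × Fin n)) (l h o : Fin n) (ω η : ℕ) : Bool :=
  decide (η < 2 ^ es.length) && inQ es l h o η && (redInsideMask es ω h &&& η) == 0

/-- What `okPairAll` guarantees. -/
lemma okPairAll_spec (es : List (Fin n × Fin n)) (l h o : Fin n) (ω η : ℕ)
    (hp : okPairAll es l h o ω η = true) :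
    η < 2 ^ es.length ∧ toConfig es.length η ∈ tgtU (endsOf es) l h {S : Set (Fin n) | o ∈ S} ∧
      ∀ e, e ∈ within (endsOf es) (cluster (endsOf es) (toConfig es.length ω) h) →
        toConfig es.length ω e = true → toConfig es.length η e = false := by
  simp only [okPairAll, Bool.and_eq_true, decide_eq_true_eq, beq_iff_eq] at hp
  obtain ⟨⟨hlt, hQ⟩, hland⟩ := hp
  refine ⟨hlt, (inQ_iff es l h o η).1 hQ, fun e he hred => ?_⟩
  have hbit : (redInsideMask es ω h).testBit e.val = true :=
    (testBit_redInsideMask_iff es ω h e).2 ⟨hred, he⟩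
  have := congrArg (fun S => S.testBit e.val) hland
  simp only [Nat.testBit_land, hbit, Bool.true_and, Nat.zero_testBit] at this
  simpa [toConfig] using this

/-- The loop over the configurations `ζ < k` with the set `seen` of images already used: every
`Q`-point is checked against its image by `okPairAll` and the images are pairwise distinct. -/
def loopAll (es : List (Fin n × Fin n)) (l h o : Fin n) (tbl : List ℕ) : ℕ → ℕ → Bool
  | 0, _ => true
  | k + 1, seen =>
    if inQ es l h o k then
      okPairAll es l h o k (tbl.getD k 0) && !seen.testBit (tbl.getD k 0) &&
        loopAll es l h o tbl k (seen ||| 2 ^ tbl.getD k 0)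
    else loopAll es l h o tbl k seen

/-- **The rigid checker**: the loop over all `2^m` configurations. -/
def checkSwAll (es : List (Fin n × Fin n)) (l h o : Fin n) (tbl : List ℕ) : Bool :=
  loopAll es l h o tbl (2 ^ es.length) 0

/-- What the loop guarantees for every `Q`-point below `k`. -/
lemma loopAll_spec (es : List (Fin n × Fin n)) (l h o : Fin n) (tbl : List ℕ) :
    ∀ (k seen : ℕ), loopAll es l h o tbl k seen = true →
      ∀ ζ, ζ < k → inQ es l h o ζ = true →
        okPairAll es l h o ζ (tbl.getD ζ 0) = true ∧ seen.testBit (tbl.getD ζ 0) = false ∧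
          ∀ ζ', ζ' < k → ζ' ≠ ζ → inQ es l h o ζ' = true → tbl.getD ζ' 0 ≠ tbl.getD ζ 0 := by
  intro k
  induction k with
  | zero => intro seen _ ζ hζ; exact absurd hζ (Nat.not_lt_zero ζ)
  | succ k ih =>
    intro seen hl ζ hζ hQ
    simp only [loopAll] at hl
    by_cases hk : inQ es l h o k = true
    · rw [if_pos hk] at hl
      simp only [Bool.and_eq_true, Bool.not_eq_true'] at hl
      obtain ⟨⟨hok, hseen⟩, hrest⟩ := hl
      have ih' := ih _ hrest
      rcases Nat.lt_succ_iff_lt_or_eq.1 hζ with hlt | rfl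
      · obtain ⟨h1, h2, h3⟩ := ih' ζ hlt hQ
        refine ⟨h1, ?_, ?_⟩
        · rw [Nat.testBit_lor] at h2
          exact (Bool.or_eq_false_iff.1 h2).1
        · intro ζ' hζ' hne hQ'
          rcases Nat.lt_succ_iff_lt_or_eq.1 hζ' with hlt' | rfl
          · exact h3 ζ' hlt' hne hQ'
          · intro heq
            rw [Nat.testBit_lor, ← heq, Nat.testBit_two_pow_self] at h2
            simp at h2
      · refine ⟨hok, hseen, ?_⟩
        intro ζ' hζ' hne hQ' heq
        have hlt' : ζ' < ζ := by
          rcases Nat.lt_succ_iff_lt_or_eq.1 hζ' with hlt' | rfl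
          · exact hlt'
          · exact absurd rfl hne
        obtain ⟨_, h2, _⟩ := ih' ζ' hlt' hQ'
        rw [Nat.testBit_lor, heq, Nat.testBit_two_pow_self] at h2
        simp at h2
    · rw [if_neg hk] at hl
      have ih' := ih _ hl
      have hlt : ζ < k := by
        rcases Nat.lt_succ_iff_lt_or_eq.1 hζ with hlt | rfl
        · exact hlt
        · exact absurd hQ hk
      obtain ⟨h1, h2, h3⟩ := ih' ζ hlt hQ
      refine ⟨h1, h2, ?_⟩
      intro ζ' hζ' hne hQ'
      rcases Nat.lt_succ_iff_lt_or_eq.1 hζ' with hlt' | rfl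
      · exact h3 ζ' hlt' hne hQ'
      · exact absurd hQ' hk

/-- **Row 2′SW-ALL from a certificate**: a table accepted by `checkSwAll` gives
`LocRows.SwAll (endsOf es) l h o`. -/
theorem swAll_of_checkSwAll (es : List (Fin n × Fin n)) (l h o : Fin n) (tbl : List ℕ)
    (hc : checkSwAll es l h o tbl = true) : SwAll (endsOf es) l h o := by
  classical
  have spec := loopAll_spec es l h o tbl _ _ hc
  let code : Config (Fin es.length) → ℕ := fun ζ => (exists_toConfig_eq es.length ζ).choose
  have hcode : ∀ ζ, code ζ < 2 ^ es.length ∧ toConfig es.length (code ζ) = ζ :=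
    fun ζ => (exists_toConfig_eq es.length ζ).choose_spec
  have hQ : ∀ x : {ζ // ζ ∈ tgtU (endsOf es) l h {S : Set (Fin n) | o ∈ S}},
      inQ es l h o (code x.1) = true := by
    intro x
    rw [inQ_iff, (hcode x.1).2]
    exact x.2
  refine ⟨fun x => toConfig es.length (tbl.getD (code x.1) 0), ?_, ?_⟩
  · intro x y hxy
    obtain ⟨hx1, _, hx3⟩ := spec (code x.1) (hcode x.1).1 (hQ x)
    obtain ⟨hy1, _, _⟩ := spec (code y.1) (hcode y.1).1 (hQ y)
    have hlt_x := (okPairAll_spec es l h o _ _ hx1).1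
    have hlt_y := (okPairAll_spec es l h o _ _ hy1).1
    have heq : tbl.getD (code x.1) 0 = tbl.getD (code y.1) 0 := by
      apply Nat.eq_of_testBit_eq
      intro i
      by_cases hi : i < es.length
      · exact congrFun hxy ⟨i, hi⟩
      · rw [Nat.testBit_lt_two_pow (lt_of_lt_of_le hlt_x (Nat.pow_le_pow_right (by omega) (by omega))),
          Nat.testBit_lt_two_pow (lt_of_lt_of_le hlt_y (Nat.pow_le_pow_right (by omega) (by omega)))]
    by_contra hne
    have hne' : code y.1 ≠ code x.1 := by
      intro h
      apply hne
      apply Subtype.ext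
      rw [← (hcode x.1).2, ← (hcode y.1).2, h]
    exact hx3 (code y.1) (hcode y.1).1 hne' (hQ y) heq.symm
  · intro x
    obtain ⟨hx1, _, _⟩ := spec (code x.1) (hcode x.1).1 (hQ x)
    obtain ⟨_, hmem, hflip⟩ := okPairAll_spec es l h o _ _ hx1
    refine ⟨hmem, ?_⟩
    rw [(hcode x.1).2] at hflip
    exact hflip

end SwCheck

end Summit.Ventures.PercRepro2
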